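import Mathlib.Analysis.Calculus.Gradient.Basic
import Mathlib.Analysis.InnerProductSpace.Laplacian
import Literature.Analysis.FluidPDE.ClassicalSolution
import Literature.Analysis.FluidPDE.ClassicalSolutionCalculus
import Literature.Analysis.FluidPDE.SpaceTimeCalculus
import Literature.Analysis.FluidPDE.RapidDecayLemmas
import Literature.Analysis.FluidPDE.SwirlMaximumPrinciple
import HarnessLib

/-!
# Whole-space minimum principle for MIX-admissible scalars

Helper file (`--supports stmt-NavierStokesRegularity-1422`, stub F2 `stub_admissibleMinPrinciple`
of line `birth`) for the crux `MixingPayoff` of route `SelfMixingDichotomy`.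

On the window `S = [T - r², T - r²/2]` (`0 < r`), a scalar `θ` that is jointly smooth on
`S × ℝ³` (`IsSmoothSpaceTimeOn`), uniformly rapidly decaying (`HasUniformRapidDecayOn`) and
solves `∂ₜθ + ⟪u, ∇θ⟫ = Δθ` pointwise, for ANY drift `u`, is nonnegative on `S × ℝ³` as soon
as `θ(T - r²) ≥ 0`.

Proof: for `ε > 0` apply the abstract weak parabolic maximum principle
`Literature.Analysis.FluidPDE.weak_max_principle` (PROVED, `SwirlMaximumPrinciple`) to
`w = -θ - ε`, `wₜ = -∂ₜθ`, on `K = B̄(0, R)`, `U = B(0, R)`, with `R` so large that `|θ| ≤ ε`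
for `‖x‖ ≥ R` (rapid decay of order zero with weight one: `(1 + ‖x‖) |θ(t, x)| ≤ C`).  At a
spatial critical point `∇(w t)(x) = 0` the gradient of `θ t` vanishes, so the drift term drops
out and `Δ(w t)(x) ≤ 0` gives `∂ₜθ = Δθ ≥ 0`, i.e. `wₜ ≤ 0`: the sub-solution implication needs
no hypothesis on `u`.  Bottom: `-θ(T - r²) - ε ≤ 0`; lateral: `-θ - ε ≤ |θ| - ε ≤ 0` on
`‖x‖ = R`.  Hence `θ ≥ -ε` on every large ball, for every `ε > 0`.
-/

noncomputable section

open Literature.Analysis.FluidPDE MeasureTheory Set Function Metric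
open scoped ContDiff

-- `Summit = Problem` for this summit; the tree lakefile sets `weak.linter.dupNamespace = false`,
-- made explicit here for out-of-tree `lean check`.
set_option linter.dupNamespace false

namespace Summit.NavierStokesRegularity.NavierStokesRegularity.Theorems

local notation "E3" => EuclideanSpace ℝ (Fin 3)

/-- **The `ε`-step of the minimum principle.** Let `θ` be jointly smooth on `[T₁, T₂] × ℝ³`
(`T₁ < T₂`), solve `∂ₜθ + ⟪u, ∇θ⟫ = Δθ` pointwise with the one-sided time derivative within
`[T₁, T₂]`, satisfy `θ(T₁) ≥ 0`, and let `ε > 0`, `R` be such that `|θ(t, x)| ≤ ε` for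
`‖x‖ ≥ R`, `t ∈ [T₁, T₂]`.  Then `-θ(t, x) - ε ≤ 0` on `[T₁, T₂] × B̄(0, R)`: the weak parabolic
maximum principle `weak_max_principle` applied to `w = -θ - ε` on `B̄(0, R) ⊇ B(0, R)`. -/
theorem admissibleScalar_neg_sub_le_zero_of_decay {T₁ T₂ ε R : ℝ} {u : ℝ → E3 → E3}
    {θ : ℝ → E3 → ℝ} (hT : T₁ < T₂) (hsm : IsSmoothSpaceTimeOn (Icc T₁ T₂) θ)
    (hpde : ∀ t ∈ Icc T₁ T₂, ∀ x : E3,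
      timeDerivWithin (Icc T₁ T₂) θ t x + inner ℝ (u t x) (gradient (θ t) x)
        = Laplacian.laplacian (θ t) x)
    (h0 : ∀ x : E3, 0 ≤ θ T₁ x) (hε : 0 < ε)
    (hR : ∀ t ∈ Icc T₁ T₂, ∀ x : E3, R ≤ ‖x‖ → |θ t x| ≤ ε) :
    ∀ t ∈ Icc T₁ T₂, ∀ x ∈ closedBall (0 : E3) R, -θ t x - ε ≤ 0 := by
  have hS : UniqueDiffOn ℝ (Icc T₁ T₂) := uniqueDiffOn_Icc hT
  -- the comparison function, its left time derivative, the compact and the open set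
  set w : ℝ → E3 → ℝ := fun t x => -θ t x - ε with hw
  set wₜ : ℝ → E3 → ℝ := fun t x => -timeDerivWithin (Icc T₁ T₂) θ t x with hwₜ
  set K : Set E3 := closedBall 0 R with hK
  set U : Set E3 := ball 0 R with hU
  have hKc : IsCompact K := isCompact_closedBall _ _
  have hUo : IsOpen U := isOpen_ball
  have hUK : U ⊆ K := ball_subset_closedBall
  -- (a) joint continuity
  have hc : ContinuousOn (uncurry w) (Icc T₁ T₂ ×ˢ K) := by
    have h1 : ContinuousOn (uncurry θ) (Icc T₁ T₂ ×ˢ K) :=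
      hsm.continuousOn.mono (prod_mono Subset.rfl (subset_univ _))
    exact h1.neg.sub continuousOn_const
  -- (b) `C²` slices
  have h2 : ∀ t ∈ Ioc T₁ T₂, ContDiff ℝ 2 (w t) := fun t ht =>
    (((hsm.contDiff_slice (Ioc_subset_Icc_self ht)).of_le (by norm_cast)).neg).sub contDiff_const
  -- (c) the left time derivative
  have ht : ∀ t ∈ Ioc T₁ T₂, ∀ x ∈ U,
      HasDerivWithinAt (fun s => w s x) (wₜ t x) (Icc T₁ t) t := by
    intro t ht x _
    exact (((hsm.hasDerivWithinAt_timeDerivWithin hS (Ioc_subset_Icc_self ht) x).neg).sub_const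
      ε).mono (Icc_subset_Icc_right ht.2)
  -- (d) the sub-solution implication: at a critical point the drift term vanishes
  have hsub : ∀ t ∈ Ioc T₁ T₂, ∀ x ∈ U, fderiv ℝ (w t) x = 0 →
      Laplacian.laplacian (w t) x ≤ 0 → wₜ t x ≤ 0 := by
    intro t ht x _ hgrad hlap
    have htS : t ∈ Icc T₁ T₂ := Ioc_subset_Icc_self ht
    have hθ2 : ContDiff ℝ 2 (θ t) := (hsm.contDiff_slice htS).of_le (by norm_cast)
    -- the gradient of `θ t` vanishes at `x`
    have hfd : fderiv ℝ (θ t) x = 0 := by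
      have e : fderiv ℝ (w t) x = -fderiv ℝ (θ t) x := by
        simp only [hw]
        rw [fderiv_sub_const, fderiv_fun_neg]
      rw [e] at hgrad
      exact neg_eq_zero.1 hgrad
    have hgr : gradient (θ t) x = 0 := by
      simp [gradient, hfd]
    -- the Laplacian of `w t` is `-Δ(θ t)`
    have hΔ : Laplacian.laplacian (w t) x = -Laplacian.laplacian (θ t) x := by
      have hfun : w t = -θ t - fun _ => ε := by
        funext y
        simp [hw]
      have hneg : ContDiffAt ℝ 2 (-θ t) x := hθ2.neg.contDiffAt
      rw [hfun, hneg.laplacian_sub contDiffAt_const, InnerProductSpace.laplacian_neg,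
        InnerProductSpace.laplacian_const]
      simp
    have hpde' := hpde t htS x
    rw [hgr, inner_zero_right, add_zero] at hpde'
    rw [hΔ] at hlap
    have : 0 ≤ timeDerivWithin (Icc T₁ T₂) θ t x := by
      rw [hpde']
      linarith
    simp only [hwₜ]
    linarith
  -- (e) the bottom `t = T₁`
  have hbot : ∀ x ∈ K, w T₁ x ≤ 0 := fun x _ => by
    simp only [hw]
    linarith [h0 x]
  -- (f) the lateral boundary `‖x‖ = R`
  have hlat : ∀ t ∈ Icc T₁ T₂, ∀ x ∈ K \ U, w t x ≤ 0 := by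
    intro t ht x hx
    have hxR : R ≤ ‖x‖ := by
      have : x ∉ ball (0 : E3) R := hx.2
      simpa using this
    have h1 := hR t ht x hxR
    have h2 : -θ t x ≤ |θ t x| := neg_le_abs _
    simp only [hw]
    linarith
  intro t htS x hx
  exact weak_max_principle hKc hUo hUK hc h2 ht hsub hbot hlat t htS x hx

/-- **Stub F2 — the whole-space minimum principle for MIX-admissible scalars.** Let
`S = [T - r², T - r²/2]`, `0 < r`, and let `θ` be jointly smooth on `S × ℝ³` with uniform rapid
decay, solving `∂ₜθ + ⟪u, ∇θ⟫ = Δθ` pointwise (any drift `u : ℝ → ℝ³ → ℝ³`, no hypothesis on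
it: at a spatial critical point `∇θ = 0` kills the drift term).  If `θ(T - r²) ≥ 0` then
`θ ≥ 0` on `S × ℝ³`.  Proof: rapid decay of order zero gives `(1 + ‖x‖)|θ(t, x)| ≤ C`, so
`|θ| ≤ ε` off the ball `B(0, C/ε)`; `admissibleScalar_neg_sub_le_zero_of_decay` (the weak maximum
principle for `-θ - ε`) gives `θ ≥ -ε` on every larger closed ball; let `ε → 0`. -/
theorem stub_admissibleMinPrinciple :
    ∀ (T r : ℝ) (u : ℝ → E3 → E3) (θ : ℝ → E3 → ℝ), 0 < r →
    IsSmoothSpaceTimeOn (Set.Icc (T - r ^ 2) (T - r ^ 2 / 2)) θ →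
    HasUniformRapidDecayOn (Set.Icc (T - r ^ 2) (T - r ^ 2 / 2)) θ →
    (∀ t ∈ Set.Icc (T - r ^ 2) (T - r ^ 2 / 2), ∀ x : E3,
      timeDerivWithin (Set.Icc (T - r ^ 2) (T - r ^ 2 / 2)) θ t x + inner ℝ (u t x) (gradient (θ t) x)
        = Laplacian.laplacian (θ t) x) →
    (∀ x : E3, 0 ≤ θ (T - r ^ 2) x) →
    ∀ t ∈ Set.Icc (T - r ^ 2) (T - r ^ 2 / 2), ∀ x : E3, 0 ≤ θ t x := by
  intro T r u θ hr hsm hd hpde h0 t ht x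
  have hT : T - r ^ 2 < T - r ^ 2 / 2 := by
    have := pow_pos hr 2
    linarith
  -- order-zero decay with weight one: `(1 + ‖y‖) |θ s y| ≤ C`
  obtain ⟨C, hC⟩ := hd 0 1
  have hC' : ∀ s ∈ Icc (T - r ^ 2) (T - r ^ 2 / 2), ∀ y : E3, (1 + ‖y‖) * |θ s y| ≤ C := by
    intro s hs y
    have := hC s hs y
    rwa [pow_one, norm_iteratedFDerivWithin_zero, Function.uncurry_apply_pair,
      Real.norm_eq_abs] at this
  refine le_of_forall_pos_le_add fun ε hε => ?_
  -- the radius beyond which `|θ| ≤ ε`, large enough to contain `x`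
  set R : ℝ := max (C / ε) ‖x‖ with hRdef
  have hdec : ∀ s ∈ Icc (T - r ^ 2) (T - r ^ 2 / 2), ∀ y : E3, R ≤ ‖y‖ → |θ s y| ≤ ε := by
    intro s hs y hy
    have h1 := hC' s hs y
    have h2 : C / ε ≤ ‖y‖ := (le_max_left _ _).trans hy
    rw [div_le_iff₀ hε] at h2
    have hpos : 0 < 1 + ‖y‖ := by positivity
    have h3 : (1 + ‖y‖) * |θ s y| ≤ (1 + ‖y‖) * ε := by nlinarith
    exact le_of_mul_le_mul_left h3 hpos
  have h := admissibleScalar_neg_sub_le_zero_of_decay hT hsm hpde h0 hε hdec t ht x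
    (mem_closedBall_zero_iff.2 (le_max_right _ _))
  linarith

end Summit.NavierStokesRegularity.NavierStokesRegularity.Theorems

end
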